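import Summits.QuantumFields.BalabanUV.Beta.GAN24.CombCarrierKernelLegBlockL1
import Summits.QuantumFields.BalabanUV.Beta.GAN24.CarrierKernelLegBottomKernel

/-!
# `BalabanUV.Beta.GAN24.CombCarrierKernelLegBottomKernel` — binder row G-an2-4 ∕ (CONV-C), TRANSFER-III (the (III′) column of RULING R-gan24p1-g46-2), THE COMB LEG DICTIONARY,
# TENTH WORD = THE PART-8a TWIN: **THE COMB-CHART CARRIER's COMPOSITE KERNEL LEG WITH AN ARBITRARY DECAYING KERNEL AT ITS LOWEST LEVEL IS `CM`-SIZED IN BLOCK MASS** — for the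
# family `G″ := update G′♮ p M` (`G′♮_j := unitK (sfStep Lc j) (smStep 3 Lc j) (GcombSh Lc j)`, `Decays M CM δM`),
# `Σ_{t ∈ box (Lc^{q+1})} |kChain (j ↦ krow G″_j Lc) p q α x″ f (Lc^{q+1}•c + t)| ≤ CM·K₈·(q+1)·e^{−κ₁‖c − x″‖∞}`
# (OWNER `b2b-balaban-gan24-p1`, gen 48; MY part 8a `CarrierKernelLegBottomKernel` re-run BY NAME on the third and sixth words; no existing file touched)

NOT IN PRINT; OUR BOOKKEEPING ([folklore] re-indexing BY NAME, the (E) proofs token for token with `coDressKBmAt (toSite rr) Lc (KInvStep Lc j) ↦ GcombSh Lc j`, the root quantifier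
dropped (centred by construction), the dressed row chain `legChain (respStepBmSeq ρ Lc)` ↦ the CONJUGATED row chain `legChain (j ↦ legComp ψ♭ R_j)` of the sixth word's
`krowInl_comb_seq` (`ψ♭ α x κ u := Ψ̂_S u x (inl κ) (inl α)`, `R_j := respStepBmSeq ρ_c Lc j`): the third word's block-ℓ¹ law `CombLegBlockL1Envelope.exists_legChain_psiLeg_blockL1_envelope`
in place of part 2's, part 3a's composition `DressedLegBlockL1MultiplierColumn.sum_box_abs_comp_mm_le ∕ summable_mul_of_decay`, part 4's `kChain_succ_left ∕ sum_box_abs_mm_le`, part 8b's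
`legChain_congr_from`, the sixth word's `klegDecay_krow_comb`; 0 `def`, 0 cited facts, 0 `def … : Prop`, 0 sorry).  HONEST FRAMING (cell contract, verbatim): «discharging `BetaPertH`
makes Bałaban's UV stability UNCONDITIONAL — a real constructive-QFT result; it is NOT the continuum limit and NOT the Clay problem.»  HONEST DEPENDENCY (verbatim): «continuum YM on
T⁴ ⇐ BetaPertH ∧ nine spine estimates (0/9 proved); BetaPertH ⇐ (D1) ∧ (D4) ∧ CAP+tail; G-an2-4 gates asym, D1 and NE2/3/4.»

WHY (gan24-formalise-leaf-03 g81's junction W4 `CombLegRowsOfNaturalWindows` displays the kernel-DRIFT windows `HWΔ` «in the (E) part-12 shape minus the root»; the (III′) part-12 twin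
`CombNaturalWindowDrift` reads, like MY (E) part 12, the swapped family's composite KERNEL legs (this word) and composite SLOT legs (the eleventh word) with the re-rooted bottom
kernels `G′♮_l + j•Δ̂_l` at the lowest level).
WHAT (`d = 3`, `2 ≤ Lc`; `M` ANY kernel with `|M x y a b| ≤ CM·e^{−δM|x−y|₁}`):
* §1 **`exists_comb_chain_comp_bottom_blockL1`** — the fifth word with the bottom kernel ABSTRACT: `∀ δM > 0, ∃ κ₁ K′, ∀ M CM …, Σ_{t ∈ box (Lc^{k+2})} |Σ′_{x′} Σ_{α′}
  legChain (j ↦ legComp ψ♭ R_j) (m+1) k α x″ α′ x′ · M (Lc•x′) (Lc^{k+2}•c + t) (inr α′) f| ≤ CM·K′·(k+1)·(Lc^{k+1})⁻¹·e^{−κ₁‖c − x″‖∞}` (`κ₁ = min κ₀ (δM∕4)`).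
* §2 `kChain_comb_update_succ` — for `G″ := update G′♮ p M` (M decaying): `kChain (j ↦ krow G″_j Lc) p (q+1) α x″ f x = (−1)^{q+1}·Σ′_{x′} Σ_{α′} legChain (j ↦ legComp ψ♭ R_j)
  (p+1) q α x″ α′ x′ · M (Lc•x′) x (inr α′) f` (part 4's sign-free `kChain_succ_left`; the field columns above level `p` are `−legComp ψ♭ R_j`, so `legChain_neg` yields the one factor
  `(−1)^{q+1}`, exactly as at (E)); `kChain_comb_update_zero`.
* §3 **`exists_kChain_comb_bottomKernel_blockMass`** — part 8a's `exists_kChain_bottomKernel_blockMass` VERBATIM for the comb-chart kernels, no root quantifier.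
Asserts NOTHING about Bałaban's tables beyond the tree's LANDED K-slot; NOT (H1Δw); NOTHING of (Q-L) ∕ (C)sym discharged; the (III′) campaign is NOT asked (an2 W-4) — typed under
R-2; NEVER «G-an2-4 closed» as (CONV-C); NOT D1, NOT `BetaPertH`, NOT continuum, NOT Clay; not in print.  Unit `b2b-balaban-gan24-p1` (BINDER row G-an2-4 OWNER), gen 48, 2026-08-25.
-/

noncomputable section

open Finset
open scoped BigOperators
open Literature.MathematicalPhysics.QuantumFieldTheory
open Literature.MathematicalPhysics.QuantumFieldTheory.LatticeForm (quo)
open Literature.MathematicalPhysics.QuantumFieldTheory.Balaban1983to89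
open Literature.MathematicalPhysics.QuantumFieldTheory.Balaban1983to89.Beta
open B4ContourShift (supNorm supNorm_nonneg)
open B12Sec2to5 (l1 l1_nonneg)
open ExpKernelCalculus (MKer Decays Zl Zl_nonneg)
open OneStepResolventKernel (Fib)
open AffineAveraging (Site box toSite)
open AveragingContours (blk off off_mem_box blk_add_off)
open AveragingContoursRooted (ctrOff ctrOff_mem_box)
open Summit.QuantumFields.BalabanUV.Beta.HessKerDressedUnits (unitK)
open Summit.QuantumFields.BalabanUV.Beta.SymCorrectorKernel (psiKS)
open Summit.QuantumFields.BalabanUV.Beta.CombChartStepJets (GcombSh)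
open Summit.QuantumFields.BalabanUV.Beta.GAN24.CombesThomas (sfStep smStep)
open Summit.QuantumFields.BalabanUV.Beta.GAN24.Push4 (legComp)
open Summit.QuantumFields.BalabanUV.Beta.GAN24.Push4Iter (LegFam legChain)
open Summit.QuantumFields.BalabanUV.Beta.GAN24.Push4LegTelescopeComb (legChain_neg)
open Summit.QuantumFields.BalabanUV.Beta.GAN24.RespStepBmDecompExact (respStepBmSeq)
open Summit.QuantumFields.BalabanUV.Beta.GAN24.LegStepPush (krow supNorm_sub_comm)
open Summit.QuantumFields.BalabanUV.Beta.GAN24.LegChainPush (kChain kChain_zero klegDecay_krow)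
open Summit.QuantumFields.BalabanUV.Beta.GAN24.DressedLegBlockL1MultiplierColumn (sum_box_abs_comp_mm_le summable_mul_of_decay)
open Summit.QuantumFields.BalabanUV.Beta.GAN24.CarrierKernelLegBlockL1 (kChain_succ_left sum_box_abs_mm_le)
open Summit.QuantumFields.BalabanUV.Beta.GAN24.CarrierSlotLegBottomKernel (legChain_congr_from)
open Summit.QuantumFields.BalabanUV.Beta.GAN24.CombLegBlockL1Envelope (exists_legChain_psiLeg_blockL1_envelope)
open Summit.QuantumFields.BalabanUV.Beta.GAN24.CombCarrierKernelLegBlockL1 (krowInl_comb_seq klegDecay_krow_comb)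

namespace Summit.QuantumFields.BalabanUV.Beta.GAN24.CombCarrierKernelLegBottomKernel

variable {Lc : ℕ} [NeZero Lc]

/-! ## §1 The conjugated row chain composed with an abstract decaying kernel at the bottom -/

/-- NOT IN PRINT; OUR BOOKKEEPING.  **THE FIFTH WORD WITH THE BOTTOM KERNEL ABSTRACT** (as displayed in the module docstring): the conjugated row chain above (the third word's
block-ℓ¹ law at the centred roots), an arbitrary decaying kernel at the bottom (part 3a's composition). -/
theorem exists_comb_chain_comp_bottom_blockL1 (hLc : 2 ≤ Lc) {δM : ℝ} (hδM : 0 < δM) :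
    ∃ κ₁ K' : ℝ, 0 < κ₁ ∧ 0 ≤ K' ∧
      ∀ (M : MKer (3 + 1) (Fib 3)) (CM : ℝ), 0 ≤ CM → (∀ x y a b, |M x y a b| ≤ CM * Real.exp (-δM * l1 (x - y))) →
      ∀ (m k : ℕ) (α : Fin (3 + 1)) (xs : Site (3 + 1)) (f : Fib 3) (c : Site (3 + 1)),
        ∑ t ∈ box (3 + 1) (Lc ^ (k + 2)),
            |∑' x', ∑ α' : Fin (3 + 1),
                legChain (fun j => legComp (fun α x κ u => psiKS (ctrOff (3 + 1) Lc) Lc u x (Sum.inl κ) (Sum.inl α))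
                    (respStepBmSeq (d := 3) (toSite (ctrOff (3 + 1) Lc)) Lc j)) (m + 1) k α xs α' x' *
                  M ((Lc : ℤ) • x') (((Lc ^ (k + 2) : ℕ) : ℤ) • c + toSite t) (Sum.inr α') f|
          ≤ CM * K' * ((k : ℝ) + 1) * ((Lc : ℝ) ^ (k + 1))⁻¹ * Real.exp (-(κ₁ * supNorm (c - xs))) := by
  classical
  have hLc1 : 1 ≤ Lc := le_trans (by norm_num) hLc
  have hr : ctrOff (3 + 1) Lc ∈ box (3 + 1) Lc := ctrOff_mem_box (show 0 < Lc by omega)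
  obtain ⟨κ₀, K, hκ₀, hK, hlaw⟩ := exists_legChain_psiLeg_blockL1_envelope (Lc := Lc)
  set κ₁ : ℝ := min κ₀ (δM / 4) with hκ₁
  have hκ₁0 : 0 < κ₁ := lt_min hκ₀ (by positivity)
  have hκ₁κ₀ : κ₁ ≤ κ₀ := min_le_left _ _
  have h4 : 4 * κ₁ ≤ δM := by have := min_le_right κ₀ (δM / 4); rw [← hκ₁] at this; linarith
  set Z : ℝ := Zl (3 + 1) (δM / 2) * Real.exp (3 * κ₁) * Zl (3 + 1) (κ₁ / ((3 : ℝ) + 1)) with hZ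
  have hZ0 : 0 ≤ Z := by
    have := Zl_nonneg (D := 3 + 1) (show 0 < δM / 2 by positivity)
    have := Zl_nonneg (D := 3 + 1) (show 0 < κ₁ / ((3 : ℝ) + 1) by positivity)
    rw [hZ]; positivity
  refine ⟨κ₁, 4 * K * Z, hκ₁0, by positivity, ?_⟩
  intro M CM hCM hMd m k α xs f c
  set U : LegFam 3 := legChain (fun j => legComp (fun α x κ u => psiKS (ctrOff (3 + 1) Lc) Lc u x (Sum.inl κ) (Sum.inl α))
      (respStepBmSeq (d := 3) (toSite (ctrOff (3 + 1) Lc)) Lc j)) (m + 1) k with hU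
  set a : ℝ := K * ((k : ℝ) + 1) * ((Lc : ℝ) ^ (k + 1))⁻¹ with ha
  have ha0 : 0 ≤ a := by rw [ha]; positivity
  have hA : ∀ (α' : Fin (3 + 1)) (c' : Site (3 + 1)),
      ∑ s ∈ box (3 + 1) (Lc ^ (k + 1)), |U α xs α' (((Lc ^ (k + 1) : ℕ) : ℤ) • c' + toSite s)| ≤ a * Real.exp (-(κ₁ * supNorm (c' - xs))) := by
    intro α' c'
    refine (hlaw _ hr _ hr (m + 1) k α xs α' c').trans ?_
    rw [ha]
    refine mul_le_mul_of_nonneg_left ?_ (by positivity)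
    rw [Real.exp_le_exp]
    have := supNorm_nonneg (c' - xs)
    nlinarith
  have hM : ∀ (α' : Fin (3 + 1)) (x' x : Site (3 + 1)), |M ((Lc : ℤ) • x') x (Sum.inr α') f| ≤ CM * Real.exp (-δM * l1 ((Lc : ℤ) • x' - x)) :=
    fun α' x' x => hMd _ _ _ _
  have hfib : ∀ α' : Fin (3 + 1), ∑ t ∈ box (3 + 1) (Lc ^ (k + 2)),
      |∑' x', U α xs α' x' * M ((Lc : ℤ) • x') (((Lc ^ (k + 2) : ℕ) : ℤ) • c + toSite t) (Sum.inr α') f|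
        ≤ a * CM * Z * Real.exp (-(κ₁ * supNorm (c - xs))) := by
    intro α'
    have h := sum_box_abs_comp_mm_le (d := 3) hLc1 k hκ₁0 hδM h4 ha0 hCM xs (hA α') (hM α') c
    refine h.trans (le_of_eq ?_)
    rw [hZ]; ring
  have hAb : ∀ (α' : Fin (3 + 1)) (x' : Site (3 + 1)), |U α xs α' x'| ≤ a := by
    intro α' x'
    haveI : NeZero (Lc ^ (k + 1)) := ⟨pow_ne_zero _ (NeZero.ne Lc)⟩
    have hL1 : 1 ≤ Lc ^ (k + 1) := Nat.one_le_pow _ _ hLc1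
    have hx := blk_add_off hL1 x'
    have h1 : |U α xs α' x'| ≤ ∑ s ∈ box (3 + 1) (Lc ^ (k + 1)), |U α xs α' (((Lc ^ (k + 1) : ℕ) : ℤ) • blk (Lc ^ (k + 1)) x' + toSite s)| := by
      conv_lhs => rw [← hx]
      exact Finset.single_le_sum (f := fun s => |U α xs α' (((Lc ^ (k + 1) : ℕ) : ℤ) • blk (Lc ^ (k + 1)) x' + toSite s)|)
        (fun _ _ => abs_nonneg _) (off_mem_box hL1 x')
    refine h1.trans ((hA α' _).trans ?_)
    have : Real.exp (-(κ₁ * supNorm (blk (Lc ^ (k + 1)) x' - xs))) ≤ 1 := by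
      rw [Real.exp_le_one_iff]; have := supNorm_nonneg (blk (Lc ^ (k + 1)) x' - xs); nlinarith
    nlinarith
  have hsum : ∀ (α' : Fin (3 + 1)) (x : Site (3 + 1)), Summable fun x' => U α xs α' x' * M ((Lc : ℤ) • x') x (Sum.inr α') f :=
    fun α' x => summable_mul_of_decay (d := 3) hLc1 hδM ha0 hCM (hAb α') (hM α') x
  calc ∑ t ∈ box (3 + 1) (Lc ^ (k + 2)), |∑' x', ∑ α' : Fin (3 + 1), U α xs α' x' * M ((Lc : ℤ) • x') (((Lc ^ (k + 2) : ℕ) : ℤ) • c + toSite t) (Sum.inr α') f|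
      = ∑ t ∈ box (3 + 1) (Lc ^ (k + 2)), |∑ α' : Fin (3 + 1), ∑' x', U α xs α' x' * M ((Lc : ℤ) • x') (((Lc ^ (k + 2) : ℕ) : ℤ) • c + toSite t) (Sum.inr α') f| :=
        Finset.sum_congr rfl fun t _ => by rw [Summable.tsum_finsetSum (fun α' _ => hsum α' _)]
    _ ≤ ∑ t ∈ box (3 + 1) (Lc ^ (k + 2)), ∑ α' : Fin (3 + 1), |∑' x', U α xs α' x' * M ((Lc : ℤ) • x') (((Lc ^ (k + 2) : ℕ) : ℤ) • c + toSite t) (Sum.inr α') f| :=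
        Finset.sum_le_sum fun t _ => Finset.abs_sum_le_sum_abs _ _
    _ = ∑ α' : Fin (3 + 1), ∑ t ∈ box (3 + 1) (Lc ^ (k + 2)), |∑' x', U α xs α' x' * M ((Lc : ℤ) • x') (((Lc ^ (k + 2) : ℕ) : ℤ) • c + toSite t) (Sum.inr α') f| :=
        Finset.sum_comm
    _ ≤ ∑ _α' : Fin (3 + 1), a * CM * Z * Real.exp (-(κ₁ * supNorm (c - xs))) := Finset.sum_le_sum fun α' _ => hfib α'
    _ = CM * (4 * K * Z) * ((k : ℝ) + 1) * ((Lc : ℝ) ^ (k + 1))⁻¹ * Real.exp (-(κ₁ * supNorm (c - xs))) := by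
        rw [Finset.sum_const, Finset.card_univ, Fintype.card_fin, nsmul_eq_mul, ha]; push_cast; ring

/-! ## §2 The composite kernel leg of the comb-chart family with a swapped bottom kernel -/

/-- [folklore] **THE SWAPPED COMB-CHART FAMILY UNROLLED AT ITS FINE END**: for `G″ := update G′♮ p M` with `M` decaying,
`kChain (j ↦ krow G″_j Lc) p (q+1) α x″ f x = (−1)^{q+1}·Σ′_{x′} Σ_{α′} legChain (j ↦ legComp ψ♭ R_j) (p+1) q α x″ α′ x′ · M (Lc•x′) x (inr α′) f` (part 4's sign-free `kChain_succ_left`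
⨾ `legChain_congr_from` ⨾ the sixth word's `krowInl_comb_seq` (field columns `= −legComp ψ♭ R_j`) ⨾ `legChain_neg`) — the (E) `kChain_update_succ` for the comb-chart kernels. -/
theorem kChain_comb_update_succ (hLc : 1 ≤ Lc) {M : MKer (3 + 1) (Fib 3)} {CM δM : ℝ} (hδM : 0 < δM)
    (hMd : ∀ x y a b, |M x y a b| ≤ CM * Real.exp (-δM * l1 (x - y))) (p q : ℕ) (α : Fin (3 + 1)) (x'' : Site (3 + 1)) (f : Fib 3) (x : Site (3 + 1)) :
    kChain (fun j => krow (Function.update (fun j => unitK (sfStep Lc j) (smStep 3 Lc j) (GcombSh (d := 3) Lc j)) p M j) Lc) p (q + 1) α x'' f x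
      = (-1 : ℝ) ^ (q + 1) * ∑' x', ∑ α' : Fin (3 + 1),
          legChain (fun j => legComp (fun α x κ u => psiKS (ctrOff (3 + 1) Lc) Lc u x (Sum.inl κ) (Sum.inl α))
              (respStepBmSeq (d := 3) (toSite (ctrOff (3 + 1) Lc)) Lc j)) (p + 1) q α x'' α' x' *
            M ((Lc : ℤ) • x') x (Sum.inr α') f := by
  -- every leg of the swapped family is localised: the comb-chart ones by the sixth word, the bottom one by `hMd`
  have hdec : ∀ j, ∃ C μ : ℝ, 0 < μ ∧ ∀ (α : Fin (3 + 1)) (x' : Site (3 + 1)) (g : Fib 3) (x : Site (3 + 1)),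
      |krow (Function.update (fun j => unitK (sfStep Lc j) (smStep 3 Lc j) (GcombSh (d := 3) Lc j)) p M j) Lc α x' g x|
        ≤ C * Real.exp (-μ * l1 (x - (Lc : ℤ) • x')) := by
    intro j
    by_cases hj : j = p
    · subst hj
      refine ⟨CM, δM, hδM, fun α x' g x => ?_⟩
      simp only [Function.update_self]
      exact klegDecay_krow (fun x y a b => hMd x y a b) Lc α x' g x
    · obtain ⟨C, μ, hμ, h⟩ := klegDecay_krow_comb (d := 3) (Lc := Lc) j
      refine ⟨C, μ, hμ, fun α x' g x => ?_⟩
      simp only [Function.update_of_ne hj]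
      exact h α x' g x
  rw [kChain_succ_left hLc hdec p q]
  -- the field columns above level `p` are the comb-chart family's: congruence from `p+1`, then the sixth word's dictionary
  have hcongr : legChain (fun j => fun (α : Fin (3 + 1)) (x'' : Site (3 + 1)) (α' : Fin (3 + 1)) (x' : Site (3 + 1)) =>
        krow (Function.update (fun j => unitK (sfStep Lc j) (smStep 3 Lc j) (GcombSh (d := 3) Lc j)) p M j) Lc α x'' (Sum.inl α') x') (p + 1) q
      = legChain (fun j => fun (α : Fin (3 + 1)) (x'' : Site (3 + 1)) (α' : Fin (3 + 1)) (x' : Site (3 + 1)) =>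
        krow (unitK (sfStep Lc j) (smStep 3 Lc j) (GcombSh (d := 3) Lc j)) Lc α x'' (Sum.inl α') x') (p + 1) q :=
    legChain_congr_from (fun j hj => by
      have hjp : j ≠ p := by omega
      simp only [Function.update_of_ne hjp]) q
  rw [hcongr, krowInl_comb_seq,
    legChain_neg (fun j => legComp (fun α x κ u => psiKS (ctrOff (3 + 1) Lc) Lc u x (Sum.inl κ) (Sum.inl α))
      (respStepBmSeq (d := 3) (toSite (ctrOff (3 + 1) Lc)) Lc j)) (p + 1) q, ← tsum_mul_left]
  refine tsum_congr fun x' => ?_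
  simp only [Pi.smul_apply, smul_eq_mul, Finset.mul_sum, mul_assoc, krow, Function.update_self]

/-- [folklore] The length-one window of the swapped comb-chart family reads the bottom kernel's full row: `kChain (j ↦ krow G″_j Lc) p 0 α x″ f x = M (Lc•x″) x (inr α) f`. -/
theorem kChain_comb_update_zero (M : MKer (3 + 1) (Fib 3)) (p : ℕ) (α : Fin (3 + 1)) (x'' : Site (3 + 1)) (f : Fib 3) (x : Site (3 + 1)) :
    kChain (fun j => krow (Function.update (fun j => unitK (sfStep Lc j) (smStep 3 Lc j) (GcombSh (d := 3) Lc j)) p M j) Lc) p 0 α x'' f x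
      = M ((Lc : ℤ) • x'') x (Sum.inr α) f := by
  simp only [kChain_zero, Function.update_self, krow]

/-! ## §3 The block mass of the comb-chart composite kernel leg with a swapped bottom kernel -/

/-- NOT IN PRINT; OUR BOOKKEEPING.  **THE COMB-CHART CARRIER's COMPOSITE KERNEL LEG WITH AN ARBITRARY DECAYING KERNEL AT ITS LOWEST LEVEL** (as displayed in the module
docstring): for every `δM > 0` ONE rate `κ₁ > 0` and ONE `K₈ ≥ 0` with, for every kernel `M` with `|M x y a b| ≤ CM·e^{−δM|x−y|₁}` (`0 ≤ CM`), every level `p`, length `q+1`, row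
`α x″`, column fibre `f` and block label `c`: `Σ_{t ∈ box (Lc^{q+1})} |kChain (j ↦ krow (update G′♮ p M j) Lc) p q α x″ f (Lc^{q+1}•c + t)| ≤ CM·K₈·(q+1)·e^{−κ₁‖c − x″‖∞}` — MY part 8a
`exists_kChain_bottomKernel_blockMass` VERBATIM for the comb-chart kernels (no root quantifier). -/
theorem exists_kChain_comb_bottomKernel_blockMass (hLc : 2 ≤ Lc) {δM : ℝ} (hδM : 0 < δM) :
    ∃ κ₁ K₈ : ℝ, 0 < κ₁ ∧ 0 ≤ K₈ ∧
      ∀ (M : MKer (3 + 1) (Fib 3)) (CM : ℝ), 0 ≤ CM → (∀ x y a b, |M x y a b| ≤ CM * Real.exp (-δM * l1 (x - y))) →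
      ∀ (p q : ℕ) (α : Fin (3 + 1)) (x'' : Site (3 + 1)) (f : Fib 3) (c : Site (3 + 1)),
        ∑ t ∈ box (3 + 1) (Lc ^ (q + 1)),
            |kChain (fun j => krow (Function.update (fun j => unitK (sfStep Lc j) (smStep 3 Lc j) (GcombSh (d := 3) Lc j)) p M j) Lc)
                p q α x'' f (((Lc ^ (q + 1) : ℕ) : ℤ) • c + toSite t)|
          ≤ CM * K₈ * ((q : ℝ) + 1) * Real.exp (-(κ₁ * supNorm (c - x''))) := by
  classical
  have hLc1 : 1 ≤ Lc := le_trans (by norm_num) hLc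
  have hLpos : (0 : ℝ) < (Lc : ℝ) := by exact_mod_cast (show 0 < Lc by omega)
  have hL1 : (1 : ℝ) ≤ Lc := by exact_mod_cast hLc1
  obtain ⟨κ₂, K', hκ₂, hK', hcomp⟩ := exists_comb_chain_comp_bottom_blockL1 (Lc := Lc) hLc hδM
  set κ₁ : ℝ := min κ₂ (δM / 4) with hκ₁
  have hκ₁0 : 0 < κ₁ := lt_min hκ₂ (by positivity)
  have hκ₁κ₂ : κ₁ ≤ κ₂ := min_le_left _ _
  have h4 : 4 * κ₁ ≤ δM := by have := min_le_right κ₂ (δM / 4); rw [← hκ₁] at this; linarith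
  have hZ := Zl_nonneg (D := 3 + 1) (show 0 < δM / 2 by positivity)
  set K₈ : ℝ := K' + Zl (3 + 1) (δM / 2) * Real.exp (2 * κ₁) with hK₈
  have hK₈0 : 0 ≤ K₈ := by rw [hK₈]; positivity
  have hexp : ∀ {κ : ℝ} (s : ℝ), 0 ≤ s → κ₁ ≤ κ → Real.exp (-(κ * s)) ≤ Real.exp (-(κ₁ * s)) := fun s hs hκ => by
    rw [Real.exp_le_exp]; nlinarith
  refine ⟨κ₁, K₈, hκ₁0, hK₈0, ?_⟩
  intro M CM hCM hMd p q α x'' f c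
  have hs : 0 ≤ supNorm (c - x'') := supNorm_nonneg _
  cases q with
  | zero =>
    -- the length-one window: the bottom kernel's row alone, block-summed at blocking `Lc`
    simp only [kChain_comb_update_zero, zero_add, pow_one, Nat.cast_zero, mul_one]
    have hM : ∀ x' x, |M ((Lc : ℤ) • x') x (Sum.inr α) f| ≤ CM * Real.exp (-δM * l1 ((Lc : ℤ) • x' - x)) := fun x' x => hMd _ _ _ _
    refine (sum_box_abs_mm_le (d := 3) hLc1 hκ₁0.le hδM h4 hCM hM x'' c).trans ?_
    rw [supNorm_sub_comm c x'']
    have h1 : CM * Zl (3 + 1) (δM / 2) * Real.exp (2 * κ₁) ≤ CM * K₈ := by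
      rw [mul_assoc]; exact mul_le_mul_of_nonneg_left (by rw [hK₈]; linarith) hCM
    have h2 : Real.exp (-(2 * κ₁) * supNorm (c - x'')) ≤ Real.exp (-(κ₁ * supNorm (c - x''))) := by
      rw [Real.exp_le_exp]; nlinarith
    exact mul_le_mul h1 h2 (Real.exp_pos _).le (mul_nonneg hCM hK₈0)
  | succ q =>
    -- length ≥ 2: the conjugated chain above, the abstract kernel at the bottom (§1), the sign invisible
    have e : ∀ t, |kChain (fun j => krow (Function.update (fun j => unitK (sfStep Lc j) (smStep 3 Lc j) (GcombSh (d := 3) Lc j)) p M j) Lc)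
          p (q + 1) α x'' f (((Lc ^ (q + 1 + 1) : ℕ) : ℤ) • c + toSite t)|
        = |∑' x', ∑ α' : Fin (3 + 1),
            legChain (fun j => legComp (fun α x κ u => psiKS (ctrOff (3 + 1) Lc) Lc u x (Sum.inl κ) (Sum.inl α))
                (respStepBmSeq (d := 3) (toSite (ctrOff (3 + 1) Lc)) Lc j)) (p + 1) q α x'' α' x' *
              M ((Lc : ℤ) • x') (((Lc ^ (q + 2) : ℕ) : ℤ) • c + toSite t) (Sum.inr α') f| := fun t => by
      rw [kChain_comb_update_succ hLc1 hδM hMd, abs_mul, abs_pow, abs_neg, abs_one, one_pow, one_mul]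
    simp only [e]
    refine (hcomp M CM hCM hMd p q α x'' f c).trans ?_
    -- `CM·K′·(q+1)·(Lc^{q+1})⁻¹ ≤ CM·K₈·(q+2)`
    have hinv : ((Lc : ℝ) ^ (q + 1))⁻¹ ≤ 1 := inv_le_one_of_one_le₀ (one_le_pow₀ hL1)
    have h1 : CM * K' * ((q : ℝ) + 1) * ((Lc : ℝ) ^ (q + 1))⁻¹ ≤ CM * K₈ * (((q + 1 : ℕ) : ℝ) + 1) := by
      have hK'le : K' ≤ K₈ := by rw [hK₈]; have := mul_nonneg hZ (Real.exp_pos (2 * κ₁)).le; linarith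
      calc CM * K' * ((q : ℝ) + 1) * ((Lc : ℝ) ^ (q + 1))⁻¹ ≤ CM * K' * ((q : ℝ) + 1) * 1 :=
            mul_le_mul_of_nonneg_left hinv (by positivity)
        _ ≤ CM * K₈ * (((q + 1 : ℕ) : ℝ) + 1) := by
            rw [mul_one]
            refine mul_le_mul (mul_le_mul_of_nonneg_left hK'le hCM) (by push_cast; linarith) (by positivity) (mul_nonneg hCM hK₈0)
    exact mul_le_mul h1 (hexp _ hs hκ₁κ₂) (Real.exp_pos _).le (by positivity)

end Summit.QuantumFields.BalabanUV.Beta.GAN24.CombCarrierKernelLegBottomKernel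

end
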